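import Literature.Probability.Process.BrownianVec
import Literature.Probability.Process.StoppedMartingale
import Literature.Probability.Process.ContinuousHitting
import Mathlib.Geometry.Manifold.PartitionOfUnity
import HarnessLib

/-!
# Harmonic functions of `d`-dimensional Brownian motion: `E[V(x₀ + W_{t ∧ T})] = V(x₀)`

Topic `Probability/Process`. For a `d`-dimensional Brownian motion `W` (`IsBrownianVec`,
`BrownianVec`) we combine Dynkin's martingale `f(x₀ + W_t) − ½∫₀ᵗ Δf(x₀ + W_r) dr`
(`IsBrownianVec.martingale_dynkin`, `f ∈ C²_c`) with the tree's continuous-time optional stopping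
(`Martingale.isAEMartingale_stoppedProcess`, `StoppedMartingale`) and hitting times of closed sets
(`isStoppingTime_hittingAfter_of_continuous`, `ContinuousHitting`) to obtain the classical
statement behind the probabilistic treatment of harmonic functions (Kakutani 1944; Le Gall
(2016), Ch. 7 §7.2, the display `u(x) = E_x[u(B_{t∧T})]` in the proof of Prop. 7.3):

* `IsBrownianVec.integral_stoppedProcess_dynkin` — **optional stopping for Dynkin's martingale**:
  `E[M^f_{t ∧ τ}] = 0` for every stopping time `τ` of the natural filtration;
* `IsBrownianVec.hitTime`, `isStoppingTime_hitTime` — the hitting time of a closed set `F` by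
  `X = x₀ + W` is a stopping time;
* `exists_contDiff_cutoff` — a `C²` (indeed smooth) cutoff equal to `1` near a compact `K ⊆ U`
  and supported in the open set `U` (Mathlib's smooth partitions of unity);
* `IsBrownianVec.integral_stoppedProcess_eq_of_harmonic` — **if `V ∈ C²(U)` with `ΔV = 0` on the
  open set `U`, `F` is closed with bounded complement, `closure Fᶜ ⊆ U` and `x₀ ∉ F`, then
  `E[V(x₀ + W_{t ∧ T_F})] = V(x₀)` for every `t`**, `T_F` the hitting time of `F`: apply optional
  stopping to Dynkin's martingale of the globally `C²_c` function `χ V` (`χ` a cutoff equal to `1`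
  near the compact `closure Fᶜ`), along whose paths up to `T_F` the correction `∫ Δ(χV)` vanishes
  and `χ V = V`.

Nothing here is specific to Brownian excursions; the statements are the general-purpose tool
for exit problems of Brownian motion in `ℝᵈ` (e.g. the transience of Brownian motion in `ℝ³` in
`BrownianVecTransience`, and [LSW] Prop. 4.1). No named fact is introduced.

## References

* S. Kakutani, *Two-dimensional Brownian motion and harmonic functions*, Proc. Imp. Acad. Tokyo
  **20** (1944) 706–714.
* J.-F. Le Gall, *Brownian Motion, Martingales, and Stochastic Calculus*, GTM 274 (2016), Ch. 7
  §7.2 ("Brownian motion and harmonic functions"), proof of Prop. 7.3: "`u(x) = E_x[u(B_{t∧T})]`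
  for every `x ∈ D'`". [Legall2016]
-/

noncomputable section

open MeasureTheory ProbabilityTheory Filter Topology Set Finset Metric
open scoped NNReal ENNReal BigOperators

namespace Literature.Probability.Process

variable {Ω : Type*} {mΩ : MeasurableSpace Ω} {P : Measure Ω} {d : ℕ}

/-! ### A smooth cutoff -/

/-- **Smooth cutoff**: for a compact `K` inside an open `U ⊆ ℝᵈ` there is a `C²` function
`χ : ℝᵈ → ℝ` with compact support contained in `U` and `χ = 1` on a neighbourhood of `K`
(Mathlib's `exists_contMDiffMap_one_nhds_of_subset_interior`). [folklore] -/
theorem exists_contDiff_cutoff {K U : Set (Fin d → ℝ)} (hK : IsCompact K) (hU : IsOpen U)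
    (hKU : K ⊆ U) :
    ∃ χ : (Fin d → ℝ) → ℝ, ContDiff ℝ 2 χ ∧ HasCompactSupport χ ∧ tsupport χ ⊆ U ∧
      ∃ O : Set (Fin d → ℝ), IsOpen O ∧ K ⊆ O ∧ O ⊆ U ∧ ∀ x ∈ O, χ x = 1 := by
  -- a compact `T ⊆ U` with `K ⊆ interior T`
  obtain ⟨δ, hδ, hδU⟩ := hK.exists_cthickening_subset_open hU hKU
  set T : Set (Fin d → ℝ) := cthickening (δ / 2) K with hT
  have hTc : IsCompact T := hK.cthickening
  have hTU : T ⊆ U := (cthickening_mono (by linarith) K).trans hδU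
  have hKint : K ⊆ interior T :=
    (self_subset_thickening (by positivity) K).trans
      (interior_maximal (thickening_subset_cthickening _ _) isOpen_thickening)
  obtain ⟨g, hg1, hg0, _⟩ := exists_contMDiffMap_one_nhds_of_subset_interior (modelWithCornersSelf ℝ (Fin d → ℝ))
    (n := 2) hK.isClosed hKint
  have hgC : ContDiff ℝ 2 g := by
    have := contMDiff_iff_contDiff.1 g.contMDiff
    simpa using this
  have hgsupp : HasCompactSupport g := HasCompactSupport.intro hTc fun x hx ↦ hg0 x hx
  -- an open set where `g = 1`
  obtain ⟨O, hO, hKO, hO1⟩ := mem_nhdsSet_iff_exists.1 hg1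
  refine ⟨g, hgC, hgsupp, ?_, O ∩ U, hO.inter hU, subset_inter hKO hKU, inter_subset_right,
    fun x hx ↦ hO1 hx.1⟩
  -- `tsupport g ⊆ T ⊆ U`
  exact (closure_minimal (fun x hx ↦ by_contra fun h ↦ (Function.mem_support.1 hx) (hg0 x h))
    hTc.isClosed).trans hTU

namespace IsBrownianVec

variable {W : ℝ≥0 → Ω → (Fin d → ℝ)} {f : (Fin d → ℝ) → ℝ} {x₀ : Fin d → ℝ}

/-! ### Optional stopping for Dynkin's martingale -/

/-- The stopped process at time `0` is the process at time `0`. [folklore] -/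
theorem stoppedProcess_zero {β : Type*} (u : ℝ≥0 → Ω → β) (τ : Ω → WithTop ℝ≥0) (ω : Ω) :
    stoppedProcess u τ 0 ω = u 0 ω := by
  simp only [stoppedProcess]
  have : min ((0 : ℝ≥0) : WithTop ℝ≥0) (τ ω) = ((0 : ℝ≥0) : WithTop ℝ≥0) := min_eq_left bot_le
  rw [this]
  rfl

/-- Dynkin's process vanishes at time `0`. [folklore] -/
theorem dynkin_zero (hW : IsBrownianVec W P) (ω : Ω) : dynkin f x₀ W 0 ω = 0 := by
  simp [dynkin, hW.apply_zero ω]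

/-- **Optional stopping for Dynkin's martingale**: `E[M^f_{t ∧ τ}] = 0` for every stopping time
`τ` of the natural filtration (the stopped martingale is an a.e. martingale, by the tree's
`Martingale.isAEMartingale_stoppedProcess`). [cite: Legall2016, Ch. 7 §7.2, proof of Prop. 7.3] -/
theorem integral_stoppedProcess_dynkin [IsProbabilityMeasure P] (hW : IsBrownianVec W P)
    (hf : ContDiff ℝ 2 f) (hc : HasCompactSupport f) (x₀ : Fin d → ℝ) {τ : Ω → WithTop ℝ≥0}
    (hτ : IsStoppingTime hW.natFiltration τ) (t : ℝ≥0) :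
    Integrable (stoppedProcess (dynkin f x₀ W) τ t) P ∧
      ∫ ω, stoppedProcess (dynkin f x₀ W) τ t ω ∂P = 0 := by
  have hM := (hW.martingale_dynkin hf hc x₀).isAEMartingale_stoppedProcess
    (ae_of_all _ fun ω ↦ hW.continuous_dynkin hf ω) hτ.isOptionalTime
  refine ⟨hM.integrable t, ?_⟩
  have h := hM.setIntegral_eq (show (0 : ℝ≥0) ≤ t from bot_le) MeasurableSet.univ
  rw [Measure.restrict_univ] at h
  rw [h]
  simp [stoppedProcess_zero, hW.dynkin_zero]

/-! ### Hitting times of closed sets by `x₀ + W` -/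

/-- **The hitting time of `F` by `X = x₀ + W`** (Mathlib `hittingAfter`, from time `0`). [folklore] -/
def hitTime (x₀ : Fin d → ℝ) (W : ℝ≥0 → Ω → (Fin d → ℝ)) (F : Set (Fin d → ℝ)) : Ω → WithTop ℝ≥0 :=
  hittingAfter (fun t ω ↦ x₀ + W t ω) F 0

/-- The hitting time of a closed set is a stopping time of the natural filtration (tree:
`isStoppingTime_hittingAfter_of_continuous`). [cite: RevuzYor1999, Ch. I Prop. (4.6)] -/
theorem isStoppingTime_hitTime (hW : IsBrownianVec W P) {F : Set (Fin d → ℝ)} (hF : IsClosed F) :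
    IsStoppingTime hW.natFiltration (hitTime x₀ W F) :=
  isStoppingTime_hittingAfter_of_continuous
    (fun t ↦ measurable_const.add (hW.measurable_apply_le (le_refl t)))
    (fun ω ↦ continuous_const.add (hW.continuous_path ω)) hF

/-- `{T_F ≤ i}` is "`F` has been visited by time `i`" (closed `F`, continuous paths). [folklore] -/
theorem hitTime_le_coe_iff (hW : IsBrownianVec W P) {F : Set (Fin d → ℝ)} (hF : IsClosed F) {ω : Ω}
    {i : ℝ≥0} : hitTime x₀ W F ω ≤ i ↔ ∃ j ≤ i, x₀ + W j ω ∈ F := by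
  have hcont : Continuous fun s : ℝ≥0 ↦ x₀ + W s ω := continuous_const.add (hW.continuous_path ω)
  exact hittingAfter_zero_le_coe_iff hF hcont

/-- A visit of `F` at time `j` bounds the hitting time by `j`. [folklore] -/
theorem hitTime_le_of_mem {F : Set (Fin d → ℝ)} {ω : Ω} {j : ℝ≥0} (h : x₀ + W j ω ∈ F) :
    hitTime x₀ W F ω ≤ j :=
  hittingAfter_le_of_mem bot_le h

/-- At a finite hitting time the path is in `F` (closed `F`, continuous paths). [folklore] -/
theorem mem_of_hitTime_eq_coe (hW : IsBrownianVec W P) {F : Set (Fin d → ℝ)} (hF : IsClosed F) {ω : Ω}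
    {T : ℝ≥0} (h : hitTime x₀ W F ω = T) : x₀ + W T ω ∈ F := by
  have hcont : Continuous fun s : ℝ≥0 ↦ x₀ + W s ω := continuous_const.add (hW.continuous_path ω)
  exact mem_of_hittingAfter_zero_eq_coe hF hcont h

/-- **Up to `t ∧ T_F` the path stays in `closure Fᶜ`** (for `x₀ ∉ F`): before `T_F` it is outside
`F`, and at `T_F` it is a limit of such points. [folklore] -/
theorem mem_closure_compl_of_le (hW : IsBrownianVec W P) {F : Set (Fin d → ℝ)} (hF : IsClosed F)
    (hx₀ : x₀ ∉ F) (t : ℝ≥0) (ω : Ω) {r : ℝ≥0}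
    (hr : r ≤ (min (t : WithTop ℝ≥0) (hitTime x₀ W F ω)).untopA) :
    x₀ + W r ω ∈ closure Fᶜ := by
  have hcont : Continuous fun s : ℝ≥0 ↦ x₀ + W s ω := continuous_const.add (hW.continuous_path ω)
  by_cases hlt : (r : WithTop ℝ≥0) < hitTime x₀ W F ω
  · exact subset_closure (notMem_of_coe_lt_hittingAfter_zero hlt)
  · -- then the hitting time is a finite time `T₀ = r`
    induction hT : hitTime x₀ W F ω with
    | top => exact absurd (hT ▸ WithTop.coe_lt_top r) hlt
    | coe T₀ =>
      rw [hT] at hlt hr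
      rw [untopA_min_coe_coe] at hr
      have hrT : r = T₀ := le_antisymm (hr.trans (min_le_right _ _)) (not_lt.1 (by exact_mod_cast hlt))
      subst hrT
      -- `X_{T₀} ∈ F`, so `T₀ ≠ 0`
      have hmem : x₀ + W r ω ∈ F := mem_of_hittingAfter_zero_eq_coe hF hcont hT
      have hr0 : r ≠ 0 := by
        rintro rfl
        rw [hW.apply_zero, add_zero] at hmem
        exact hx₀ hmem
      -- the closed set of good times contains `[0, r)`, hence `r`
      have hS : IsClosed {s : ℝ≥0 | x₀ + W s ω ∈ closure Fᶜ} := isClosed_closure.preimage hcont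
      have hsub : Iio r ⊆ {s : ℝ≥0 | x₀ + W s ω ∈ closure Fᶜ} := fun s hs ↦ by
        have hs' : (s : WithTop ℝ≥0) < hitTime x₀ W F ω := by rw [hT]; exact_mod_cast hs
        exact subset_closure (show x₀ + W s ω ∈ Fᶜ from notMem_of_coe_lt_hittingAfter_zero hs')
      have hcl : closure (Iio r) ⊆ {s : ℝ≥0 | x₀ + W s ω ∈ closure Fᶜ} := closure_minimal hsub hS
      apply hcl
      rw [closure_Iio' ⟨0, pos_iff_ne_zero.2 hr0⟩]
      exact Set.self_mem_Iic

/-! ### Harmonic functions: `E[V(x₀ + W_{t ∧ T_F})] = V(x₀)` -/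

/-- Functions agreeing near `y` have the same Laplacian at `y`. [folklore] -/
theorem lap_congr_of_eventuallyEq {g₁ g₂ : (Fin d → ℝ) → ℝ} {y : Fin d → ℝ} (h : g₁ =ᶠ[𝓝 y] g₂) :
    lap g₁ y = lap g₂ y := by
  have h2 : hess g₁ y = hess g₂ y := by
    unfold hess
    exact (h.fderiv (𝕜 := ℝ)).fderiv_eq
  simp [lap, h2]

/-- **Kakutani / Doob: harmonic functions of Brownian motion, stopped form.** Let `U ⊆ ℝᵈ` be
open, `V : ℝᵈ → ℝ` of class `C²` on `U` with `ΔV = 0` on `U`; let `F` be closed with bounded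
complement and `closure Fᶜ ⊆ U`, and `x₀ ∉ F`. Then for every `t ≥ 0`,
`E[V(x₀ + W_{t ∧ T_F})] = V(x₀)`, where `T_F` is the hitting time of `F` by `x₀ + W` (and the
stopped value is integrable). [cite: Legall2016, Ch. 7 §7.2, proof of Prop. 7.3 (display u(x) = E_x[u(B_{t∧T})])] -/
theorem integral_stoppedProcess_eq_of_harmonic [IsProbabilityMeasure P] (hW : IsBrownianVec W P)
    {U : Set (Fin d → ℝ)} (hU : IsOpen U) {V : (Fin d → ℝ) → ℝ} (hV : ContDiffOn ℝ 2 V U)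
    (hΔ : ∀ y ∈ U, lap V y = 0) {F : Set (Fin d → ℝ)} (hF : IsClosed F)
    (hbdd : Bornology.IsBounded Fᶜ) (hFU : closure Fᶜ ⊆ U) {x₀ : Fin d → ℝ} (hx₀ : x₀ ∉ F)
    (t : ℝ≥0) :
    Integrable (stoppedProcess (fun r ω ↦ V (x₀ + W r ω)) (hitTime x₀ W F) t) P ∧
      ∫ ω, stoppedProcess (fun r ω ↦ V (x₀ + W r ω)) (hitTime x₀ W F) t ω ∂P = V x₀ := by
  set K : Set (Fin d → ℝ) := closure Fᶜ with hKdef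
  have hK : IsCompact K := Metric.isCompact_of_isClosed_isBounded isClosed_closure hbdd.closure
  obtain ⟨χ, hχ, hχc, hχU, O, hO, hKO, hOU, hχ1⟩ := exists_contDiff_cutoff hK hU hFU
  -- the globally `C²_c` function `g = χ V`
  set g : (Fin d → ℝ) → ℝ := fun y ↦ χ y * V y with hgdef
  have hgV : ∀ y ∈ O, g =ᶠ[𝓝 y] V := fun y hy ↦ by
    filter_upwards [hO.mem_nhds hy] with z hz
    simp [hgdef, hχ1 z hz]
  have hg2 : ContDiff ℝ 2 g := by
    rw [contDiff_iff_contDiffAt]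
    intro y
    by_cases hy : y ∈ U
    · exact (hχ.contDiffAt).mul (hV.contDiffAt (hU.mem_nhds hy))
    · -- off `U`, hence off `tsupport χ`, `g` vanishes near `y`
      have hy' : y ∉ tsupport χ := fun h ↦ hy (hχU h)
      have h0 : g =ᶠ[𝓝 y] fun _ ↦ 0 := by
        filter_upwards [(isClosed_tsupport χ).isOpen_compl.mem_nhds hy'] with z hz
        simp [hgdef, image_eq_zero_of_notMem_tsupport hz]
      exact (contDiffAt_const (c := (0 : ℝ))).congr_of_eventuallyEq h0
  have hgc : HasCompactSupport g := hχc.mul_right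
  have hlapg : ∀ y ∈ O, lap g y = 0 := fun y hy ↦ by
    rw [lap_congr_of_eventuallyEq (hgV y hy)]
    exact hΔ y (hOU hy)
  have hgK : ∀ y ∈ K, g y = V y := fun y hy ↦ by simp [hgdef, hχ1 y (hKO hy)]
  -- optional stopping for Dynkin's martingale of `g` at `T_F`
  obtain ⟨hint, h0⟩ := hW.integral_stoppedProcess_dynkin hg2 hgc x₀ (hW.isStoppingTime_hitTime hF (x₀ := x₀)) t
  -- along the stopped path, `M^g = V(X) − V(x₀)`
  have hx₀K : x₀ ∈ K := subset_closure hx₀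
  have hpath : ∀ ω, stoppedProcess (dynkin g x₀ W) (hitTime x₀ W F) t ω =
      stoppedProcess (fun r ω ↦ V (x₀ + W r ω)) (hitTime x₀ W F) t ω - V x₀ := by
    intro ω
    simp only [stoppedProcess, dynkin]
    set σ : ℝ≥0 := (min (t : WithTop ℝ≥0) (hitTime x₀ W F ω)).untopA with hσ
    have hmemK : ∀ r : ℝ≥0, r ≤ σ → x₀ + W r ω ∈ K := fun r hr ↦
      hW.mem_closure_compl_of_le hF hx₀ t ω hr
    have hI : ∫ r in (0 : ℝ)..σ, lap g (x₀ + W r.toNNReal ω) = 0 := by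
      rw [intervalIntegral.integral_congr (g := fun _ ↦ (0 : ℝ)) fun r hr ↦ ?_,
        intervalIntegral.integral_zero]
      rw [uIcc_of_le σ.coe_nonneg] at hr
      exact hlapg _ (hKO (hmemK _ (Real.toNNReal_le_iff_le_coe.2 hr.2)))
    rw [hI, hgK _ (hmemK σ le_rfl), hgK _ hx₀K]
    ring
  have hpath' : stoppedProcess (fun r ω ↦ V (x₀ + W r ω)) (hitTime x₀ W F) t =
      fun ω ↦ stoppedProcess (dynkin g x₀ W) (hitTime x₀ W F) t ω + V x₀ := by
    funext ω; rw [hpath ω]; ring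
  refine ⟨?_, ?_⟩
  · rw [hpath']
    exact hint.add (integrable_const _)
  · rw [hpath', integral_add hint (integrable_const _), h0]
    simp

/-! ### Unbounded regions: exhaustion by balls -/

/-- The hitting time of a larger set is earlier. [folklore] -/
theorem hitTime_mono {F G : Set (Fin d → ℝ)} (h : F ⊆ G) (ω : Ω) : hitTime x₀ W G ω ≤ hitTime x₀ W F ω :=
  hittingAfter_apply_anti _ _ ω h

/-- If the extra set `G` is not visited up to time `t`, then stopping at `t ∧ T_{F ∪ G}` is stopping
at `t ∧ T_F`. [folklore] -/
theorem min_hitTime_union_eq (hW : IsBrownianVec W P) {F G : Set (Fin d → ℝ)} (hF : IsClosed F)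
    (hG : IsClosed G) {t : ℝ≥0} {ω : Ω} (hnot : ∀ s ≤ t, x₀ + W s ω ∉ G) :
    min (t : WithTop ℝ≥0) (hitTime x₀ W (F ∪ G) ω) = min (t : WithTop ℝ≥0) (hitTime x₀ W F ω) := by
  have hcont : Continuous fun s : ℝ≥0 ↦ x₀ + W s ω := continuous_const.add (hW.continuous_path ω)
  have hle : hitTime x₀ W (F ∪ G) ω ≤ hitTime x₀ W F ω := hitTime_mono Set.subset_union_left ω
  by_cases h : hitTime x₀ W (F ∪ G) ω ≤ t
  · -- the union is hit by time `t`, at a point of `F`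
    obtain ⟨T, hT⟩ := WithTop.ne_top_iff_exists.1 (ne_top_of_le_ne_top WithTop.coe_ne_top h)
    have hmem : x₀ + W T ω ∈ F ∪ G := mem_of_hittingAfter_zero_eq_coe (hF.union hG) hcont hT.symm
    have hTt : T ≤ t := by rw [← hT] at h; exact_mod_cast h
    have hmemF : x₀ + W T ω ∈ F := hmem.resolve_right (hnot T hTt)
    have hge : hitTime x₀ W F ω ≤ T := hittingAfter_le_of_mem bot_le hmemF
    have heq : hitTime x₀ W (F ∪ G) ω = hitTime x₀ W F ω := le_antisymm hle (hT ▸ hge)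
    rw [heq]
  · push Not at h
    rw [min_eq_left h.le, min_eq_left (h.le.trans hle)]

/-- **Harmonic functions of Brownian motion, stopped form, unbounded region.** As
`integral_stoppedProcess_eq_of_harmonic`, but `Fᶜ` need not be bounded; instead `V` is assumed
bounded on `closure Fᶜ`: `E[V(x₀ + W_{t ∧ T_F})] = V(x₀)` (exhaust by the balls `‖y − x₀‖ < R`
and pass to the limit by dominated convergence; each path is bounded on `[0, t]`).
[cite: Legall2016, Ch. 7 §7.2, proof of Prop. 7.3] -/
theorem integral_stoppedProcess_eq_of_harmonic' [IsProbabilityMeasure P] (hW : IsBrownianVec W P)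
    {U : Set (Fin d → ℝ)} (hU : IsOpen U) {V : (Fin d → ℝ) → ℝ} (hV : ContDiffOn ℝ 2 V U)
    (hΔ : ∀ y ∈ U, lap V y = 0) {F : Set (Fin d → ℝ)} (hF : IsClosed F) (hFU : closure Fᶜ ⊆ U)
    {C : ℝ} (hVC : ∀ y ∈ closure Fᶜ, |V y| ≤ C) {x₀ : Fin d → ℝ} (hx₀ : x₀ ∉ F) (t : ℝ≥0) :
    Integrable (stoppedProcess (fun r ω ↦ V (x₀ + W r ω)) (hitTime x₀ W F) t) P ∧
      ∫ ω, stoppedProcess (fun r ω ↦ V (x₀ + W r ω)) (hitTime x₀ W F) t ω ∂P = V x₀ := by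
  -- the far sets `G n = {‖y − x₀‖ ≥ n + 1}` and the truncated obstacles `F ∪ G n`
  set G : ℕ → Set (Fin d → ℝ) := fun n ↦ {y | (n : ℝ) + 1 ≤ ‖y - x₀‖} with hGdef
  have hGc : ∀ n, IsClosed (G n) := fun n ↦ isClosed_le continuous_const (continuous_id.sub continuous_const).norm
  have hFn : ∀ n, IsClosed (F ∪ G n) := fun n ↦ hF.union (hGc n)
  have hbdd : ∀ n, Bornology.IsBounded (F ∪ G n)ᶜ := fun n ↦ by
    rw [compl_union]
    refine (Metric.isBounded_closedBall (x := x₀) (r := n + 1)).subset fun y hy ↦ ?_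
    simp only [mem_inter_iff, mem_compl_iff, hGdef, mem_setOf_eq, not_le] at hy
    rw [Metric.mem_closedBall, dist_eq_norm]
    exact hy.2.le
  have hsubn : ∀ n, (F ∪ G n)ᶜ ⊆ Fᶜ := fun n ↦ compl_subset_compl.2 Set.subset_union_left
  have hclU : ∀ n, closure (F ∪ G n)ᶜ ⊆ U := fun n ↦ (closure_mono (hsubn n)).trans hFU
  have hx₀n : ∀ n : ℕ, x₀ ∉ F ∪ G n := fun n h ↦ h.elim hx₀ fun h' ↦ by
    simp only [hGdef, mem_setOf_eq, sub_self, norm_zero] at h'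
    linarith
  have hstep : ∀ n, Integrable (stoppedProcess (fun r ω ↦ V (x₀ + W r ω)) (hitTime x₀ W (F ∪ G n)) t) P ∧
      ∫ ω, stoppedProcess (fun r ω ↦ V (x₀ + W r ω)) (hitTime x₀ W (F ∪ G n)) t ω ∂P = V x₀ := fun n ↦
    hW.integral_stoppedProcess_eq_of_harmonic hU hV hΔ (hFn n) (hbdd n) (hclU n) (hx₀n n) t
  -- pointwise the truncated stopped values are eventually the untruncated one
  have hev : ∀ ω, ∀ᶠ n : ℕ in atTop, stoppedProcess (fun r ω ↦ V (x₀ + W r ω)) (hitTime x₀ W (F ∪ G n)) t ω =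
      stoppedProcess (fun r ω ↦ V (x₀ + W r ω)) (hitTime x₀ W F) t ω := by
    intro ω
    -- the path is bounded on `[0, t]`
    have hcont : Continuous fun s : ℝ≥0 ↦ ‖W s ω‖ := (hW.continuous_path ω).norm
    obtain ⟨M, hM⟩ := (isCompact_Icc (a := (0 : ℝ≥0)) (b := t)).bddAbove_image hcont.continuousOn
    obtain ⟨N, hN⟩ := exists_nat_gt M
    refine eventually_atTop.2 ⟨N, fun n hn ↦ ?_⟩
    have hnot : ∀ s ≤ t, x₀ + W s ω ∉ G n := fun s hs hsG ↦ by
      simp only [hGdef, mem_setOf_eq, add_sub_cancel_left] at hsG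
      have h1 : ‖W s ω‖ ≤ M := hM ⟨s, ⟨bot_le, hs⟩, rfl⟩
      have h2 : (N : ℝ) ≤ n := by exact_mod_cast hn
      linarith
    simp only [stoppedProcess]
    rw [hW.min_hitTime_union_eq hF (hGc n) hnot]
  -- domination by `C`
  have hbound : ∀ n ω, |stoppedProcess (fun r ω ↦ V (x₀ + W r ω)) (hitTime x₀ W (F ∪ G n)) t ω| ≤ C := by
    intro n ω
    simp only [stoppedProcess]
    refine hVC _ (closure_mono (hsubn n) ?_)
    exact hW.mem_closure_compl_of_le (hFn n) (hx₀n n) t ω le_rfl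
  have hmeas : ∀ n, AEStronglyMeasurable
      (stoppedProcess (fun r ω ↦ V (x₀ + W r ω)) (hitTime x₀ W (F ∪ G n)) t) P := fun n ↦
    (hstep n).1.aestronglyMeasurable
  have hlim_meas : AEStronglyMeasurable (stoppedProcess (fun r ω ↦ V (x₀ + W r ω)) (hitTime x₀ W F) t) P :=
    aestronglyMeasurable_of_tendsto_ae atTop hmeas
      (ae_of_all _ fun ω ↦ tendsto_nhds_of_eventually_eq (hev ω))
  have hint : Integrable (stoppedProcess (fun r ω ↦ V (x₀ + W r ω)) (hitTime x₀ W F) t) P := by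
    refine Integrable.mono' (integrable_const C) hlim_meas (ae_of_all _ fun ω ↦ ?_)
    obtain ⟨n, hn⟩ := (hev ω).exists
    rw [Real.norm_eq_abs, ← hn]
    exact hbound n ω
  refine ⟨hint, ?_⟩
  have hconv := tendsto_integral_of_dominated_convergence (fun _ ↦ C) hmeas (integrable_const C)
    (fun n ↦ ae_of_all _ fun ω ↦ by rw [Real.norm_eq_abs]; exact hbound n ω)
    (ae_of_all _ fun ω ↦ tendsto_nhds_of_eventually_eq (hev ω))
  have hconst : Tendsto (fun n : ℕ ↦ ∫ ω, stoppedProcess (fun r ω ↦ V (x₀ + W r ω)) (hitTime x₀ W (F ∪ G n)) t ω ∂P)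
      atTop (𝓝 (V x₀)) := by
    simp_rw [fun n ↦ (hstep n).2]
    exact tendsto_const_nhds
  exact tendsto_nhds_unique hconv hconst

end IsBrownianVec

end Literature.Probability.Process

end
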